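import Literature.IUT.LogVolume.TameQuadraticCoordinates
import HarnessLib

/-!
# Isometries of the tame quadratic `p`-adic field `K = ℚ_p(π)`, `π² = p`, `p` odd, are UNITS OF THE INTEGRAL GALOIS ORDER `𝒪_K⟨Gal⟩`

Classical local algebra (nothing disputed; the [IUTchIV] locator records where the abc-iut cell uses it).
Let `K` be an ultrametric normed field over `ℚ_p` with `[K : ℚ_p] = 2` and `π ∈ K`, `π² = p` (so `K = ℚ_p(√p)`, totally
and — for `p` odd — TAMELY ramified).  We prove:

* `conj` — the non-trivial `ℚ_p`-algebra automorphism `σ : a + bπ ↦ a − bπ` of `K` (`conj_pi : σ π = −π`), built from the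
  basis `(1, π)` of `TameQuadraticCoordinates` (multiplicativity checked on coordinates); `conj_ne_refl`.
* **`exists_coeffs_of_isometry`** — for `p` ODD, every `ℚ_p`-linear ISOMETRY `g` of `K` is
  `g = c₁·id + c_σ·σ` with `‖c₁‖ ≤ 1`, `‖c_σ‖ ≤ 1`: writing `g 1 = a₁ + b₁π`, `g π = a₂ + b₂π` (`isometry_coeff_bounds`:
  `‖a₁‖ ≤ 1`, `‖b₁‖‖π‖ ≤ 1`, `‖a₂‖ ≤ ‖π‖`, `‖b₂‖ ≤ 1`) one has `c₁ = ½((a₁ + b₂) + (b₁ + a₂/p)π)`,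
  `c_σ = ½((a₁ − b₂) + (b₁ − a₂/p)π)`, integral because `‖2‖ = 1` and `‖a₂/p‖‖π‖ = ‖a₂‖/‖π‖ ≤ 1`.
* **`exists_galoisOrder_of_isometry`** / `exists_galoisOrder_of_isometry_symm` — the same packaged in the shape
  «`∃ (T : Finset (K ≃ₐ[ℚ_p] K)) (c : _ → K), (∀ τ ∈ T, ‖c τ‖ ≤ 1) ∧ ∀ y, g y = Σ_{τ ∈ T} c τ · τ y`» (with `T = {1, σ}`),
  for `g` and for `g⁻¹` — i.e. `g` is a UNIT of the integral Galois order `𝒪_K⟨Aut_{ℚ_p}(K)⟩ = {y ↦ Σ_τ c_τ·τ(y) : c_τ ∈ 𝒪_K}`.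
* `exists_tameQuadratic_isometry_galoisOrder` — NON-VACUITY inside `ℚ̄_p` (`E = ℚ_p(√p)`, every odd `p`).

Use (abc-iut cell, R-J row Y-29b): this is exactly the per-place binder shape `hIsmG` / `hIsmL` of
`Joshi/TestRealPinsInhabitedGaloisOrderIsm.lean` (p460152) / `Joshi/TestRealPinsIsometricDividingLine.lean` (p460595) («(Ind2) acts
through units of the integral Galois orders»), DISCHARGED for ALL isometries at a tame quadratic place `ℚ_p(√p)`, `p` odd, with NO
further hypothesis — the ORDER route; it covers packets with any number of factors and MIXED places over one prime through p460152 §0,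
complementing the PACKET route of `TameQuadraticIsometryStable.lean` (p459049: two equal factors).  Relation to the general lemma
`IsometryGaloisOrder.lean` (p462048: `K/ℚ_p` finite GALOIS + a NORM-UNIMODULAR trace-dual pair `(b, d)` as HYPOTHESES ⟹ the same
shape): at `K = ℚ_p(√p)` that lemma's hypotheses hold with `b = (1, π)`, `d = (½, 1/(2π))` — here neither the Galois property nor the
pair is assumed; the conjugation `σ` is CONSTRUCTED and the coefficients are solved for directly.  At a WILD place the isometric shear
of `Joshi/TestRealPinsIsometricShear.lean` (p457646) lies outside the order.  CONTAINERS only; no side is taken on [IUTchIII]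
Cor. 3.12.  Theorems + three explicit `def`s (`conjLin`, `conjAlgHom`, `conj`: the conjugation as a linear map / algebra hom /
algebra automorphism); no `Prop` definition.  General form: the twisted case `π² = ε·p`, `‖ε‖ = 1` (`K = ℚ_p(√(εp))`) — indeed
EVERY quadratic `K` at odd `p`, with no uniformiser hypothesis — is covered by the sequel `TameDegreeIsometryGaloisOrder.lean`
(`TameDegree.exists_galoisOrder_repr_of_isometry_of_finrank_two`, abc-iut-E-t52 gen 6) through abc-iut-E-t42's one-axis criterion
`TameDualPair.exists_galoisOrder_repr_of_isometry_of_not_wild` (p464861); the explicit coordinates proof below stays for `π² = p`.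
Locators: Neukirch II (4.8) = unique extension of `|·|_p` to `K` (`|α| = |N(α)|^{1/n}`: `‖π‖² = ‖p‖`, the isometry / norm clauses),
II (4.9) = max-norm in the coordinates of a basis (here `(1, π)`), Serre III §3 = trace duality / the integral Galois order.
[cite: NeukirchANT1999, Ch. II (4.8)] [cite: NeukirchANT1999, Ch. II (4.9)] [cite: SerreLocalFields1979, Ch. III §3, Prop. 7] [cite: Mochizuki2012, IUTchIV Prop. 1.1 p. 9]
-/

noncomputable section

open Metric Set

namespace Literature.IUT.LogVolume

namespace TameQuadratic

variable {p : ℕ} [Fact p.Prime]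
variable {K : Type*} [NontriviallyNormedField K] [NormedAlgebra ℚ_[p] K] {π : K}

/-! ## Scalars of `ℚ_p` inside `K` -/

/-- `a • x = ι(a)·x` with `ι = algebraMap ℚ_p K`. [cite: NeukirchANT1999, Ch. II (4.9)] -/
theorem smul_eq_algebraMap_mul (a : ℚ_[p]) (x : K) : a • x = algebraMap ℚ_[p] K a * x := Algebra.smul_def a x

/-- `(2 : K) ≠ 0` (`K ⊇ ℚ_p` has characteristic `0`). [cite: NeukirchANT1999, Ch. II (4.9)] -/
theorem two_ne_zero' (p : ℕ) [Fact p.Prime] [NormedAlgebra ℚ_[p] K] : (2 : K) ≠ 0 := by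
  have h : algebraMap ℚ_[p] K 2 = (2 : K) := map_ofNat _ 2
  rw [← h, map_ne_zero]
  norm_num

/-- `(p : K) ≠ 0`. [cite: NeukirchANT1999, Ch. II (4.9)] -/
theorem natCast_p_ne_zero (p : ℕ) [Fact p.Prime] [NormedAlgebra ℚ_[p] K] : (p : K) ≠ 0 := by
  have h : algebraMap ℚ_[p] K (p : ℚ_[p]) = (p : K) := map_natCast _ p
  rw [← h, map_ne_zero]
  exact_mod_cast (Fact.out : p.Prime).ne_zero

/-- Product of two elements written in the basis `(1, π)`: `(s + tπ)(s′ + t′π) = (ss′ + p·tt′) + (st′ + ts′)π`.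
[cite: NeukirchANT1999, Ch. II (4.9)] -/
theorem combo_mul_combo (hπ : π ^ 2 = (p : K)) (s t s' t' : ℚ_[p]) :
    (s • (1 : K) + t • π) * (s' • (1 : K) + t' • π) =
      (s * s' + (p : ℚ_[p]) * t * t') • (1 : K) + (s * t' + t * s') • π := by
  simp only [smul_eq_algebraMap_mul, map_add, map_mul, map_natCast]
  linear_combination (algebraMap ℚ_[p] K t * algebraMap ℚ_[p] K t') * hπ

/-! ## The conjugation `σ : a + bπ ↦ a − bπ` -/

section Conj

variable [IsUltrametricDist K] (hK : Module.finrank ℚ_[p] K = 2) (hπ : π ^ 2 = (p : K))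
include hK hπ

/-- The `ℚ_p`-linear map `a + bπ ↦ a − bπ` (on the basis `(1, π)` of `exists_basis`: `1 ↦ 1`, `π ↦ −π`).
[cite: NeukirchANT1999, Ch. II (4.9)] -/
def conjLin : K →ₗ[ℚ_[p]] K := ((exists_basis hK hπ).choose).constr ℚ_[p] ![(1 : K), -π]

/-- `conjLin 1 = 1`. [cite: NeukirchANT1999, Ch. II (4.9)] -/
theorem conjLin_one : conjLin hK hπ 1 = 1 := by
  obtain ⟨hB0, -⟩ := (exists_basis hK hπ).choose_spec
  have h : conjLin hK hπ ((exists_basis hK hπ).choose 0) = ![(1 : K), -π] 0 :=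
    Module.Basis.constr_basis _ ℚ_[p] _ 0
  rw [hB0] at h
  exact h

/-- `conjLin π = −π`. [cite: NeukirchANT1999, Ch. II (4.9)] -/
theorem conjLin_pi : conjLin hK hπ π = -π := by
  obtain ⟨-, hB1⟩ := (exists_basis hK hπ).choose_spec
  have h : conjLin hK hπ ((exists_basis hK hπ).choose 1) = ![(1 : K), -π] 1 :=
    Module.Basis.constr_basis _ ℚ_[p] _ 1
  rw [hB1] at h
  exact h

/-- `conjLin (s + tπ) = s − tπ`. [cite: NeukirchANT1999, Ch. II (4.9)] -/
theorem conjLin_combo (s t : ℚ_[p]) : conjLin hK hπ (s • (1 : K) + t • π) = s • (1 : K) + (-t) • π := by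
  rw [map_add, map_smul, map_smul, conjLin_one, conjLin_pi, smul_neg, neg_smul]

/-- `conjLin` is multiplicative. [cite: NeukirchANT1999, Ch. II (4.9)] -/
theorem conjLin_mul (x y : K) : conjLin hK hπ (x * y) = conjLin hK hπ x * conjLin hK hπ y := by
  obtain ⟨hB0, hB1⟩ := (exists_basis hK hπ).choose_spec
  set B := (exists_basis hK hπ).choose
  conv_lhs => rw [← combo_repr B hB0 hB1 x, ← combo_repr B hB0 hB1 y, combo_mul_combo hπ, conjLin_combo]
  conv_rhs => rw [← combo_repr B hB0 hB1 x, ← combo_repr B hB0 hB1 y, conjLin_combo, conjLin_combo, combo_mul_combo hπ]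
  congr 1 <;> congr 1 <;> ring

/-- `conjLin ∘ conjLin = id`. [cite: NeukirchANT1999, Ch. II (4.9)] -/
theorem conjLin_conjLin (x : K) : conjLin hK hπ (conjLin hK hπ x) = x := by
  obtain ⟨hB0, hB1⟩ := (exists_basis hK hπ).choose_spec
  set B := (exists_basis hK hπ).choose
  conv_lhs => rw [← combo_repr B hB0 hB1 x, conjLin_combo, conjLin_combo, neg_neg]
  exact combo_repr B hB0 hB1 x

/-- `conjLin` as a `ℚ_p`-algebra endomorphism. [cite: NeukirchANT1999, Ch. II (4.9)] -/
def conjAlgHom : K →ₐ[ℚ_[p]] K := AlgHom.ofLinearMap (conjLin hK hπ) (conjLin_one hK hπ) (conjLin_mul hK hπ)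

/-- **The conjugation `σ ∈ Aut_{ℚ_p-alg}(K)`**, `σ(a + bπ) = a − bπ` — the generator of `Gal(ℚ_p(√p)/ℚ_p)`.
[cite: NeukirchANT1999, Ch. II (4.8)] [cite: NeukirchANT1999, Ch. II (4.9)] -/
def conj : K ≃ₐ[ℚ_[p]] K :=
  AlgEquiv.ofAlgHom (conjAlgHom hK hπ) (conjAlgHom hK hπ) (by ext x; exact conjLin_conjLin hK hπ x)
    (by ext x; exact conjLin_conjLin hK hπ x)

/-- `σ x = conjLin x`. [cite: NeukirchANT1999, Ch. II (4.9)] -/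
theorem conj_apply (x : K) : conj hK hπ x = conjLin hK hπ x := rfl

/-- `σ π = −π`. [cite: NeukirchANT1999, Ch. II (4.9)] -/
theorem conj_pi : conj hK hπ π = -π := by rw [conj_apply, conjLin_pi]

/-- `σ (s + tπ) = s − tπ`. [cite: NeukirchANT1999, Ch. II (4.9)] -/
theorem conj_combo (s t : ℚ_[p]) : conj hK hπ (s • (1 : K) + t • π) = s • (1 : K) + (-t) • π := by
  rw [conj_apply, conjLin_combo]

/-- `σ ≠ 1` (`σ π = −π ≠ π` since `π ≠ 0` and `2 ≠ 0`). [cite: NeukirchANT1999, Ch. II (4.9)] -/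
theorem conj_ne_refl : conj hK hπ ≠ AlgEquiv.refl := by
  intro h
  have h1 : conj hK hπ π = π := by rw [h]; rfl
  rw [conj_pi] at h1
  have h2 : (2 : K) * π = 0 := by linear_combination -h1
  rcases mul_eq_zero.mp h2 with h3 | h3
  · exact two_ne_zero' p h3
  · exact pi_ne_zero hπ h3

end Conj

/-! ## Isometries are `𝒪_K`-combinations of `1` and `σ` (`p` odd) -/

/-- `‖a/p‖·‖π‖ ≤ 1` when `‖a‖ ≤ ‖π‖` (`‖π‖² = p⁻¹`, so `‖a/p‖·‖π‖ = ‖a‖/‖π‖`). [cite: NeukirchANT1999, Ch. II (4.8)] -/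
theorem norm_div_p_mul_norm_pi_le (hπ : π ^ 2 = (p : K)) {a : ℚ_[p]} (ha : ‖a‖ ≤ ‖π‖) :
    ‖a / (p : ℚ_[p])‖ * ‖π‖ ≤ 1 := by
  have hπ0 := norm_pi_pos hπ
  have hp' : ‖(p : ℚ_[p])‖ = (p : ℝ)⁻¹ := Padic.norm_p
  have hsq : ‖π‖ ^ 2 = (p : ℝ)⁻¹ := norm_pi_sq hπ
  rw [norm_div, hp', ← hsq]
  calc ‖a‖ / ‖π‖ ^ 2 * ‖π‖ = ‖a‖ / ‖π‖ := by field_simp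
    _ ≤ 1 := (div_le_one hπ0).2 ha

section Isometry

variable [IsUltrametricDist K]

/-- `‖½(u + vπ)‖ ≤ 1` when `‖u‖ ≤ 1`, `‖v‖‖π‖ ≤ 1` (`‖2‖ = 1`, `p` odd). [cite: NeukirchANT1999, Ch. II (4.8)] -/
theorem norm_half_combo_le (hp : p ≠ 2) (hπ : π ^ 2 = (p : K)) {u v : ℚ_[p]} (hu : ‖u‖ ≤ 1) (hv : ‖v‖ * ‖π‖ ≤ 1) :
    ‖(2 : K)⁻¹ * (u • (1 : K) + v • π)‖ ≤ 1 := by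
  rw [norm_mul, norm_inv, norm_two p hp, inv_one, one_mul, norm_combo hπ]
  exact max_le hu hv

/-- **Every `ℚ_p`-linear ISOMETRY of `K = ℚ_p(√p)`, `p` odd, is `c₁·id + c_σ·σ` with `c₁, c_σ ∈ 𝒪_K`.** With `g 1 = a₁ + b₁π`,
`g π = a₂ + b₂π`: `c₁ = ½((a₁ + b₂) + (b₁ + a₂/p)π)`, `c_σ = ½((a₁ − b₂) + (b₁ − a₂/p)π)`; `c₁ + c_σ = g 1` and
`(c₁ − c_σ)·π = a₂ + b₂π = g π`; integrality from `isometry_coeff_bounds` and `‖2‖ = 1`. [cite: NeukirchANT1999, Ch. II (4.8)] [cite: NeukirchANT1999, Ch. II (4.9)] -/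
theorem exists_coeffs_of_isometry (hp : p ≠ 2) (hK : Module.finrank ℚ_[p] K = 2) (hπ : π ^ 2 = (p : K))
    (g : K ≃ₗ[ℚ_[p]] K) (hg : ∀ x, ‖g x‖ = ‖x‖) :
    ∃ c₁ c₂ : K, ‖c₁‖ ≤ 1 ∧ ‖c₂‖ ≤ 1 ∧ ∀ y, g y = c₁ * y + c₂ * conj hK hπ y := by
  obtain ⟨hB0, hB1⟩ := (exists_basis hK hπ).choose_spec
  set B := (exists_basis hK hπ).choose
  obtain ⟨ha₁, hb₁, ha₂, hb₂⟩ := isometry_coeff_bounds B hπ hB0 hB1 g hg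
  set a₁ := B.repr (g 1) 0
  set b₁ := B.repr (g 1) 1
  set a₂ := B.repr (g π) 0
  set b₂ := B.repr (g π) 1
  refine ⟨(2 : K)⁻¹ * ((a₁ + b₂) • (1 : K) + (b₁ + a₂ / (p : ℚ_[p])) • π),
    (2 : K)⁻¹ * ((a₁ - b₂) • (1 : K) + (b₁ - a₂ / (p : ℚ_[p])) • π), ?_, ?_, fun y => ?_⟩
  · refine norm_half_combo_le hp hπ ((IsUltrametricDist.norm_add_le_max _ _).trans (max_le ha₁ hb₂)) ?_
    calc ‖b₁ + a₂ / (p : ℚ_[p])‖ * ‖π‖ ≤ max ‖b₁‖ ‖a₂ / (p : ℚ_[p])‖ * ‖π‖ :=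
          mul_le_mul_of_nonneg_right (IsUltrametricDist.norm_add_le_max _ _) (norm_nonneg _)
      _ ≤ 1 := by
          rw [max_mul_of_nonneg _ _ (norm_nonneg π)]
          exact max_le hb₁ (norm_div_p_mul_norm_pi_le hπ ha₂)
  · refine norm_half_combo_le hp hπ ?_ ?_
    · rw [sub_eq_add_neg]
      exact (IsUltrametricDist.norm_add_le_max _ _).trans (max_le ha₁ (by rw [norm_neg]; exact hb₂))
    · calc ‖b₁ - a₂ / (p : ℚ_[p])‖ * ‖π‖ ≤ max ‖b₁‖ ‖a₂ / (p : ℚ_[p])‖ * ‖π‖ := by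
            rw [sub_eq_add_neg]
            refine mul_le_mul_of_nonneg_right ?_ (norm_nonneg _)
            exact (IsUltrametricDist.norm_add_le_max _ _).trans (by rw [norm_neg])
        _ ≤ 1 := by
            rw [max_mul_of_nonneg _ _ (norm_nonneg π)]
            exact max_le hb₁ (norm_div_p_mul_norm_pi_le hπ ha₂)
  · -- expand `y`, `g 1`, `g π` in the basis and compare
    set s := B.repr y 0
    set t := B.repr y 1
    have hy : s • (1 : K) + t • π = y := combo_repr B hB0 hB1 y
    have hg1 : g 1 = a₁ • (1 : K) + b₁ • π := (combo_repr B hB0 hB1 (g 1)).symm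
    have hgπ : g π = a₂ • (1 : K) + b₂ • π := (combo_repr B hB0 hB1 (g π)).symm
    have hgy : g y = s • g 1 + t • g π := by
      conv_lhs => rw [← hy]
      rw [map_add, map_smul, map_smul]
    rw [hgy, hg1, hgπ]
    conv_rhs => rw [← hy, conj_combo hK hπ]
    haveI : CharZero K := charZero_of_injective_algebraMap (algebraMap ℚ_[p] K).injective
    have hp0 : (p : K) ≠ 0 := Nat.cast_ne_zero.2 (Fact.out : p.Prime).ne_zero
    simp only [smul_eq_algebraMap_mul, map_add, map_sub, map_neg, map_div₀, map_natCast]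
    field_simp
    linear_combination (-2 * algebraMap ℚ_[p] K t * algebraMap ℚ_[p] K a₂) * hπ

/-- **Every isometry of `ℚ_p(√p)` (`p` odd) is a member of the integral Galois order `𝒪_K⟨Aut_{ℚ_p}(K)⟩`** — the binder shape
`hIsmG` of the abc-iut cell's `Joshi/TestRealPinsInhabitedGaloisOrderIsm.lean` (p460152): `T = {1, σ}`.
[cite: SerreLocalFields1979, Ch. III §3, Prop. 7] [cite: NeukirchANT1999, Ch. II (4.8)] [cite: Mochizuki2012, IUTchIV Prop. 1.1 p. 9] -/
theorem exists_galoisOrder_of_isometry (hp : p ≠ 2) (hK : Module.finrank ℚ_[p] K = 2) (hπ : π ^ 2 = (p : K))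
    (g : K ≃ₗ[ℚ_[p]] K) (hg : ∀ x, ‖g x‖ = ‖x‖) :
    ∃ (T : Finset (K ≃ₐ[ℚ_[p]] K)) (c : (K ≃ₐ[ℚ_[p]] K) → K), (∀ τ ∈ T, ‖c τ‖ ≤ 1) ∧ ∀ y, g y = ∑ τ ∈ T, c τ * τ y := by
  classical
  obtain ⟨c₁, c₂, hc₁, hc₂, hgy⟩ := exists_coeffs_of_isometry hp hK hπ g hg
  refine ⟨{AlgEquiv.refl, conj hK hπ}, fun τ => if τ = AlgEquiv.refl then c₁ else c₂, fun τ _ => ?_, fun y => ?_⟩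
  · dsimp only
    split_ifs
    · exact hc₁
    · exact hc₂
  · rw [Finset.sum_pair (conj_ne_refl hK hπ).symm]
    dsimp only
    rw [if_pos rfl, if_neg (conj_ne_refl hK hπ), hgy y]
    rfl

/-- … and so is its inverse (an isometry as well): `g` is a UNIT of the integral Galois order.
[cite: SerreLocalFields1979, Ch. III §3, Prop. 7] [cite: NeukirchANT1999, Ch. II (4.8)] [cite: Mochizuki2012, IUTchIV Prop. 1.1 p. 9] -/
theorem exists_galoisOrder_of_isometry_symm (hp : p ≠ 2) (hK : Module.finrank ℚ_[p] K = 2) (hπ : π ^ 2 = (p : K))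
    (g : K ≃ₗ[ℚ_[p]] K) (hg : ∀ x, ‖g x‖ = ‖x‖) :
    ∃ (T : Finset (K ≃ₐ[ℚ_[p]] K)) (c : (K ≃ₐ[ℚ_[p]] K) → K), (∀ τ ∈ T, ‖c τ‖ ≤ 1) ∧
      ∀ y, g.symm y = ∑ τ ∈ T, c τ * τ y :=
  exists_galoisOrder_of_isometry hp hK hπ g.symm fun x => by
    conv_rhs => rw [← g.apply_symm_apply x]
    rw [hg]

end Isometry

end TameQuadratic

/-! ## Non-vacuity: `ℚ_p(√p) ⊆ ℚ̄_p`, `p` odd -/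

/-- **NON-VACUITY: at `ℚ_p(√p)`, `p` ODD, EVERY `ℚ_p`-linear isometry is a unit of the integral Galois order.**  For every odd
prime `p` there is a finite `E ⊆ ℚ̄_p` with `[E : ℚ_p] = 2` (namely `E = ℚ_p(√p)`) such that every `ℚ_p`-linear isometry `g` of
`E`, together with `g⁻¹`, is `Σ_{τ ∈ T} c_τ·τ` with `τ ∈ Aut_{ℚ_p}(E)`, `‖c_τ‖ ≤ 1` — the hypothesis `hIsmG`/`hIsmL` of the
abc-iut cell's dividing-line files holds for the FULL isometric (Ind2) at such a place.
[cite: NeukirchANT1999, Ch. II (4.8)] [cite: SerreLocalFields1979, Ch. III §3, Prop. 7] [cite: Mochizuki2012, IUTchIV Prop. 1.1 p. 9] -/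
theorem exists_tameQuadratic_isometry_galoisOrder (p : ℕ) [Fact p.Prime] (hp : p ≠ 2) :
    ∃ (E : IntermediateField ℚ_[p] (PadicAlgCl p)) (_ : FiniteDimensional ℚ_[p] E),
      Module.finrank ℚ_[p] E = 2 ∧
        ∀ (g : (E : Type) ≃ₗ[ℚ_[p]] E), (∀ x, ‖g x‖ = ‖x‖) →
          (∃ (T : Finset ((E : Type) ≃ₐ[ℚ_[p]] E)) (c : ((E : Type) ≃ₐ[ℚ_[p]] E) → E),
              (∀ τ ∈ T, ‖c τ‖ ≤ 1) ∧ ∀ y, g y = ∑ τ ∈ T, c τ * τ y) ∧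
          (∃ (T : Finset ((E : Type) ≃ₐ[ℚ_[p]] E)) (c : ((E : Type) ≃ₐ[ℚ_[p]] E) → E),
              (∀ τ ∈ T, ‖c τ‖ ≤ 1) ∧ ∀ y, g.symm y = ∑ τ ∈ T, c τ * τ y) := by
  obtain ⟨E, π, hfd, hK, hπ⟩ := TameQuadratic.exists_subfield p
  exact ⟨E, hfd, hK, fun g hg => ⟨TameQuadratic.exists_galoisOrder_of_isometry (K := E) hp hK hπ g hg,
    TameQuadratic.exists_galoisOrder_of_isometry_symm (K := E) hp hK hπ g hg⟩⟩

end Literature.IUT.LogVolume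

end
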